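import Mathlib
import Summits.NavierStokesRegularity.NavierStokesRegularity.Theorems.FilamentSkeletonRssSkeletonJ1RLiaDefectDerivAssembly

/-!
# Crux `SkeletonJ1R` (stmt-NavierStokesRegularity-23610) · line `streamline_kantorovich_R` · stub F2-d (`LiaDefectDerivBL`, v7):
# THE REMAINING ESTIMATE SPLITS INTO A SELF-STRAND PART AND A PARTNER PART (the derivative analogues of B1 / B2 of the F2-B chain)

Lead `ns-fsr-lead-23610` g2, `--supports stmt-NavierStokesRegularity-23610 --as helper`.  MODEL rung, NEGATIVE side of the ladder: estimates for a
HYPOTHETICAL filament-type blow-up skeleton; nothing here is a claim about Navier–Stokes regularity; the stub and the crux stay OPEN.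

`liaDefectDerivBL_of_self_and_partner_deriv_bounds` — `LiaDefectDerivBL` follows from TWO estimates at interior collar points `ℓ² ≤ ‖x_j τ‖² < 2ℓ²`
(both with the quantifier prefix of `LiaDefectBL`):
* (B1′, self strand) `ℓ·‖P⊥(c_j Ȧ_j − β·(x_j′ × (β⁻¹(x_j″ × W + x_j′ × DW·x_j′)) + x_j″ × x_j″))‖ ≤ C (√Γ+|τ|)/√log Γ` — the derivative along the
  reference of the self-strand local-induction residual (`Ȧ_j` the matched-kernel directional integral, `W = ambientField`);
* (B2′, partners) `ℓ·Σ_{k≠j} ‖c_k (Ȧ_k − Ḃ_k)‖ ≤ C (√Γ+|τ|)/√log Γ` — the derivative of the partners' filament-vs-datum-line mismatch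
  (`Ḃ_k` the Lorentzian derivative in closed form);
via `…LiaDefectDerivAssembly.liaDefectDerivBL_of_perpResidualDeriv_bound` and uniqueness of the derivative (`…ResidualForm.IsLiaReference.hasDerivAt_residual`).
-/

set_option linter.dupNamespace false -- `NavierStokesRegularity.NavierStokesRegularity` path/namespace repetition is the tree convention

noncomputable section

namespace Summit.NavierStokesRegularity.NavierStokesRegularity.Theorems.SkeletonJ1RFrame

open Set Function Filter Real Topology MeasureTheory
open Literature.Analysis.FluidPDE
open Summit.NavierStokesRegularity.NavierStokesRegularity.Theorems.FilamentSkeletonRssSkeletonJ1GSplit (NearStraightJ1G StraightDatum)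
open scoped InnerProductSpace BigOperators

/-- `‖P⊥(u + v)‖ ≤ ‖P⊥u‖ + ‖v‖` for a unit vector `P`. [folklore] -/
theorem norm_perp_add_le (P u v : EuclideanSpace ℝ (Fin 3)) (hP : ‖P‖ = 1) :
    ‖(u + v) - ⟪u + v, P⟫_ℝ • P‖ ≤ ‖u - ⟪u, P⟫_ℝ • P‖ + ‖v‖ := by
  have h : (u + v) - ⟪u + v, P⟫_ℝ • P = (u - ⟪u, P⟫_ℝ • P) + (v - ⟪v, P⟫_ℝ • P) := by
    rw [inner_add_left, add_smul]; abel
  rw [h]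
  exact (norm_add_le _ _).trans (add_le_add le_rfl (norm_perpTo_le P v hP))

set_option maxHeartbeats 1600000 in
/-- **`LiaDefectDerivBL` FROM THE SELF-STRAND AND PARTNER DERIVATIVE BOUNDS** (B1′ and B2′ of the module docstring). [folklore] -/
theorem liaDefectDerivBL_of_self_and_partner_deriv_bounds
    (hself : ∀ (N : ℕ) (δd ρd Λd Rwd θd mw : ℝ) (p t : Fin N → EuclideanSpace ℝ (Fin 3)) (γ : Fin N → ℝ) (α : ℝ) (s₀ : Fin N → ℝ),
      0 < N → 0 < δd → 0 < ρd → 0 < Rwd → 0 < θd → 0 < mw → StraightDatum N δd ρd Λd Rwd θd mw p t γ α s₀ →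
      (∀ j k, j ≠ k → |⟪t j, t k⟫_ℝ| ≤ 1 - θd) →
      ∃ Rb₁ : ℝ, 0 < Rb₁ ∧ ∀ Rb : ℝ, 0 < Rb → Rb ≤ Rb₁ → ∃ (Γ₁ Cs : ℝ), ∀ Γ : ℝ, Γ₁ ≤ Γ →
        ∀ (x : Fin N → ℝ → EuclideanSpace ℝ (Fin 3)) (M : EuclideanSpace ℝ (Fin 3) → EuclideanSpace ℝ (Fin 3)),
          IsLiaReference Γ Rb p t γ α s₀ x → SlicedFrame Γ ρd 1 Rb p t s₀ x M →
          ∀ j τ, (Rb * Real.sqrt (Γ * Real.log Γ)) ^ 2 ≤ ‖x j τ‖ ^ 2 → ‖x j τ‖ ^ 2 < 2 * (Rb * Real.sqrt (Γ * Real.log Γ)) ^ 2 →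
            Rb * Real.sqrt (Γ * Real.log Γ) *
              ‖((Γ * γ j / (4 * Real.pi)) • (∫ σ : ℝ, ((-3 * ⟪x j τ - x j σ, deriv (x j) τ⟫_ℝ *
                    ((‖x j τ - x j σ‖ ^ 2 + Real.exp (-(1 + Real.eulerMascheroniConstant - Real.log 2)) * (1:ℝ)) ^ (5 / 2 : ℝ))⁻¹) •
                  cross (deriv (x j) σ) (x j τ - x j σ) +
                ((‖x j τ - x j σ‖ ^ 2 + Real.exp (-(1 + Real.eulerMascheroniConstant - Real.log 2)) * (1:ℝ)) ^ (3 / 2 : ℝ))⁻¹ •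
                  cross (deriv (x j) σ) (deriv (x j) τ))) -
                liaCoeff Γ γ j • (cross (deriv (x j) τ) ((liaCoeff Γ γ j)⁻¹ • (cross (deriv (deriv (x j)) τ) (ambientField Γ p t γ α s₀ j (x j τ)) +
                    cross (deriv (x j) τ) (fderiv ℝ (ambientField Γ p t γ α s₀ j) (x j τ) (deriv (x j) τ)))) +
                  cross (deriv (deriv (x j)) τ) (deriv (deriv (x j)) τ))) -
              ⟪(Γ * γ j / (4 * Real.pi)) • (∫ σ : ℝ, ((-3 * ⟪x j τ - x j σ, deriv (x j) τ⟫_ℝ *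
                    ((‖x j τ - x j σ‖ ^ 2 + Real.exp (-(1 + Real.eulerMascheroniConstant - Real.log 2)) * (1:ℝ)) ^ (5 / 2 : ℝ))⁻¹) •
                  cross (deriv (x j) σ) (x j τ - x j σ) +
                ((‖x j τ - x j σ‖ ^ 2 + Real.exp (-(1 + Real.eulerMascheroniConstant - Real.log 2)) * (1:ℝ)) ^ (3 / 2 : ℝ))⁻¹ •
                  cross (deriv (x j) σ) (deriv (x j) τ))) -
                liaCoeff Γ γ j • (cross (deriv (x j) τ) ((liaCoeff Γ γ j)⁻¹ • (cross (deriv (deriv (x j)) τ) (ambientField Γ p t γ α s₀ j (x j τ)) +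
                    cross (deriv (x j) τ) (fderiv ℝ (ambientField Γ p t γ α s₀ j) (x j τ) (deriv (x j) τ)))) +
                  cross (deriv (deriv (x j)) τ) (deriv (deriv (x j)) τ)), deriv (x j) τ⟫_ℝ • deriv (x j) τ‖ ≤
              Cs * (Real.sqrt Γ + |τ|) / Real.sqrt (Real.log Γ))
    (hpart : ∀ (N : ℕ) (δd ρd Λd Rwd θd mw : ℝ) (p t : Fin N → EuclideanSpace ℝ (Fin 3)) (γ : Fin N → ℝ) (α : ℝ) (s₀ : Fin N → ℝ),
      0 < N → 0 < δd → 0 < ρd → 0 < Rwd → 0 < θd → 0 < mw → StraightDatum N δd ρd Λd Rwd θd mw p t γ α s₀ →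
      (∀ j k, j ≠ k → |⟪t j, t k⟫_ℝ| ≤ 1 - θd) →
      ∃ Rb₁ : ℝ, 0 < Rb₁ ∧ ∀ Rb : ℝ, 0 < Rb → Rb ≤ Rb₁ → ∃ (Γ₁ Cp : ℝ), ∀ Γ : ℝ, Γ₁ ≤ Γ →
        ∀ (x : Fin N → ℝ → EuclideanSpace ℝ (Fin 3)) (M : EuclideanSpace ℝ (Fin 3) → EuclideanSpace ℝ (Fin 3)),
          IsLiaReference Γ Rb p t γ α s₀ x → SlicedFrame Γ ρd 1 Rb p t s₀ x M →
          ∀ j τ, (Rb * Real.sqrt (Γ * Real.log Γ)) ^ 2 ≤ ‖x j τ‖ ^ 2 → ‖x j τ‖ ^ 2 < 2 * (Rb * Real.sqrt (Γ * Real.log Γ)) ^ 2 →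
            Rb * Real.sqrt (Γ * Real.log Γ) *
              ∑ k ∈ Finset.univ.erase j, ‖(Γ * γ k / (4 * Real.pi)) • ((∫ σ : ℝ, ((-3 * ⟪x j τ - x k σ, deriv (x j) τ⟫_ℝ *
                    ((‖x j τ - x k σ‖ ^ 2 + Real.exp (-(1 + Real.eulerMascheroniConstant - Real.log 2)) * (1:ℝ)) ^ (5 / 2 : ℝ))⁻¹) •
                  cross (deriv (x k) σ) (x j τ - x k σ) +
                ((‖x j τ - x k σ‖ ^ 2 + Real.exp (-(1 + Real.eulerMascheroniConstant - Real.log 2)) * (1:ℝ)) ^ (3 / 2 : ℝ))⁻¹ •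
                  cross (deriv (x k) σ) (deriv (x j) τ))) -
                ((-(2 * (2 * ⟪x j τ - waistPt Γ p t s₀ k, deriv (x j) τ⟫_ℝ -
                      2 * ⟪x j τ - waistPt Γ p t s₀ k, t k⟫_ℝ * ⟪deriv (x j) τ, t k⟫_ℝ)) /
                    (‖x j τ - waistPt Γ p t s₀ k‖ ^ 2 - ⟪x j τ - waistPt Γ p t s₀ k, t k⟫_ℝ ^ 2 +
                      Real.exp (-(1+Real.eulerMascheroniConstant-Real.log 2)) * (1:ℝ)) ^ 2) • cross (t k) (x j τ - waistPt Γ p t s₀ k) +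
                (2 / (‖x j τ - waistPt Γ p t s₀ k‖ ^ 2 - ⟪x j τ - waistPt Γ p t s₀ k, t k⟫_ℝ ^ 2 +
                    Real.exp (-(1+Real.eulerMascheroniConstant-Real.log 2)) * (1:ℝ))) • cross (t k) (deriv (x j) τ)))‖ ≤
              Cp * (Real.sqrt Γ + |τ|) / Real.sqrt (Real.log Γ)) :
    LiaDefectDerivBL := by
  refine liaDefectDerivBL_of_perpResidualDeriv_bound ?_
  intro N δd ρd Λd Rwd θd mw p t γ α s₀ hN hδ hρ hRw hθ hmw hSD hGP
  obtain ⟨RbS, hRbS0, hS⟩ := hself N δd ρd Λd Rwd θd mw p t γ α s₀ hN hδ hρ hRw hθ hmw hSD hGP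
  obtain ⟨RbP, hRbP0, hPn⟩ := hpart N δd ρd Λd Rwd θd mw p t γ α s₀ hN hδ hρ hRw hθ hmw hSD hGP
  have ht : ∀ k, ‖t k‖ = 1 := hSD.1
  refine ⟨min RbS (min RbP 4), lt_min hRbS0 (lt_min hRbP0 (by norm_num)), fun Rb hRb hRble => ?_⟩
  have hRbS : Rb ≤ RbS := hRble.trans (min_le_left _ _)
  have hRbP : Rb ≤ RbP := hRble.trans ((min_le_right _ _).trans (min_le_left _ _))
  have hRb4 : Rb ≤ 4 := hRble.trans ((min_le_right _ _).trans (min_le_right _ _))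
  obtain ⟨ΓS, Cs, hSΓ⟩ := hS Rb hRb hRbS
  obtain ⟨ΓP, Cp, hPΓ⟩ := hPn Rb hRb hRbP
  refine ⟨max (Real.exp 1) (max ΓS ΓP), Cs + Cp, fun Γ hΓ x M hx hSF j τ hlow hint R' hR' => ?_⟩
  have hΓS : ΓS ≤ Γ := ((le_max_left _ _).trans (le_max_right _ _)).trans hΓ
  have hΓP : ΓP ≤ Γ := ((le_max_right _ _).trans (le_max_right _ _)).trans hΓ
  have hΓe1 : Real.exp 1 ≤ Γ := (le_max_left _ _).trans hΓ
  have hΓ1 : 1 < Γ := lt_of_lt_of_le (by have := Real.add_one_lt_exp (one_ne_zero (α := ℝ)); linarith) hΓe1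
  have hΓ0 : 0 < Γ := by linarith
  have hlog1 : 1 ≤ Real.log Γ := by rw [Real.le_log_iff_exp_le hΓ0]; exact hΓe1
  have hℓ0 : 0 < Rb * Real.sqrt (Γ * Real.log Γ) := by
    have : 0 < Real.sqrt (Γ * Real.log Γ) := Real.sqrt_pos.2 (by positivity); positivity
  have hℓ : Rb * Real.sqrt (Γ * Real.log Γ) ≠ 0 := hℓ0.ne'
  -- linear escape
  have htilt := hSF.1.2.1
  set C0 : ℝ := ∑ k, ‖x k 0‖ with hC0
  have hC0k : ∀ k, ‖x k 0‖ ≤ C0 := fun k =>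
    Finset.single_le_sum (f := fun k => ‖x k 0‖) (fun k _ => norm_nonneg _) (Finset.mem_univ k)
  have hxg : ∀ k σ, (1/2:ℝ) * |σ| - C0 ≤ ‖x k σ‖ := fun k σ =>
    le_trans (by linarith [hC0k k]) (hx.norm_ge_half_abs_sub ht htilt hRb4 k σ)
  -- the explicit derivative and uniqueness
  have hR := hx.hasDerivAt_residual ht (by norm_num : (0:ℝ) < 1/2) hxg hℓ j τ hint.le
  have hEq := hR'.unique hR
  have hP1 : ‖deriv (x j) τ‖ = 1 := (hx j).2.1 τ
  have h1 := hSΓ Γ hΓS x M hx hSF j τ hlow hint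
  have h2 := hPΓ Γ hΓP x M hx hSF j τ hlow hint
  have hrf0 : 0 ≤ (Real.sqrt Γ + |τ|) / Real.sqrt (Real.log Γ) := by positivity
  rw [hEq]
  calc Rb * Real.sqrt (Γ * Real.log Γ) * ‖_‖
      ≤ Rb * Real.sqrt (Γ * Real.log Γ) * (‖_‖ + ‖_‖) :=
        mul_le_mul_of_nonneg_left (norm_perp_add_le _ _ _ hP1) hℓ0.le
    _ ≤ Rb * Real.sqrt (Γ * Real.log Γ) * ‖_‖ + Rb * Real.sqrt (Γ * Real.log Γ) * ∑ k ∈ Finset.univ.erase j, ‖_‖ := by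
        rw [mul_add]; gcongr; exact norm_sum_le _ _
    _ ≤ Cs * (Real.sqrt Γ + |τ|) / Real.sqrt (Real.log Γ) + Cp * (Real.sqrt Γ + |τ|) / Real.sqrt (Real.log Γ) := add_le_add h1 h2
    _ = (Cs + Cp) * (Real.sqrt Γ + |τ|) / Real.sqrt (Real.log Γ) := by ring

end Summit.NavierStokesRegularity.NavierStokesRegularity.Theorems.SkeletonJ1RFrame

end
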